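import Summits.MatrixMultiplication.MatrixMultiplication.Theorems.SoloInformedValTwoBlockCriterion

/-!
# Face inequalities for two-block configurations: thin blocks never pack superlinearly

Solo-informed MatrixMultiplication, gen 77 (dossier `paper/val-superlinear.md` §15.8 (k)).

Two complete blocks `X₁ × Y₁ × Z₁`, `X₂ × Y₂ × Z₂` (identity potentials in an abelian group `G`) whose union is
accidental-free satisfy the additive criterion of `SoloInformedValTwoBlockCriterion`.  Here we extract a
CARDINALITY consequence of one cross pattern: pattern `(2,1,2)` (`CrossFree X₂ Y₂ Y₁ Z₁ Z₂ X₂`) says that the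
difference set `Y₁ − Z₁` is disjoint from every translate `x₀ + (Y₂ − X₂ − Z₂)`, `x₀ ∈ X₂`; the additive TPP of
block 2 makes `(x, y, z) ↦ y − x − z` injective on the block (`AddTPP.card_image_translate`), the additive TPP of
block 1 makes `(y, z) ↦ y − z` injective (`AddTPP.card_image_sub`), hence the FACE INEQUALITY
(`AddTPP.face_add_volume_le`)

  `|X₂||Y₂||Z₂| + |Y₁||Z₁| ≤ |G|`.

Consequently (`AddTPP.two_le_card_of_superlinear`) if the pair is superlinear, `|G| < v₁ + v₂`, then `|X₁| ≥ 2`;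
by symmetry (the other five patterns) every side of both blocks is at least `2` — blocks with a side of size one
never take part in a superlinear two-block configuration, which prunes the seat's two-block census.

Elementary; no `sorry`.
-/

namespace Summit.MatrixMultiplication.MatrixMultiplication.Theorems.SoloVal

open Finset

section TwoBlockFaces

variable {G : Type*} [AddCommGroup G] [DecidableEq G]

/-- Under the additive TPP the map `(x, y, z) ↦ g + (y - x - z)` is injective on `X × Y × Z`: its image has
`|X||Y||Z|` elements. -/
theorem AddTPP.card_image_translate {X Y Z : Finset G} (h : AddTPP X Y Z) (g : G) :
    ((X ×ˢ Y ×ˢ Z).image (fun t => g + (t.2.1 - t.1 - t.2.2))).card = X.card * Y.card * Z.card := by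
  have hinj : Set.InjOn (fun t : G × G × G => g + (t.2.1 - t.1 - t.2.2)) ↑(X ×ˢ Y ×ˢ Z) := by
    rintro ⟨x, y, z⟩ hm ⟨x', y', z'⟩ hm' heq
    simp only [Finset.coe_product, Set.mem_prod, Finset.mem_coe] at hm hm'
    have heq' : y - x - z = y' - x' - z' := add_left_cancel heq
    have h0 : (x' - y') + (y - z) + (z' - x) = 0 := by
      rw [← sub_eq_zero] at heq'
      calc (x' - y') + (y - z) + (z' - x) = y - x - z - (y' - x' - z') := by abel
        _ = 0 := heq'
    obtain ⟨hx, hy, hz⟩ := h hm'.1 hm.1 hm'.2.1 hm.2.1 hm.2.2 hm'.2.2 h0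
    rw [hx, hy, hz]
  rw [Finset.card_image_of_injOn hinj, Finset.card_product, Finset.card_product, Nat.mul_assoc]

/-- Under the additive TPP (and `X` non-empty) the map `(y, z) ↦ y - z` is injective on `Y × Z`. -/
theorem AddTPP.card_image_sub {X Y Z : Finset G} (h : AddTPP X Y Z) (hX : X.Nonempty) :
    ((Y ×ˢ Z).image (fun p => p.1 - p.2)).card = Y.card * Z.card := by
  obtain ⟨x₀, hx₀⟩ := hX
  have hinj : Set.InjOn (fun p : G × G => p.1 - p.2) ↑(Y ×ˢ Z) := by
    rintro ⟨y, z⟩ hm ⟨y', z'⟩ hm' heq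
    simp only [Finset.coe_product, Set.mem_prod, Finset.mem_coe] at hm hm'
    have heq' : y - z = y' - z' := heq
    have h0 : (x₀ - y') + (y - z) + (z' - x₀) = 0 := by
      rw [← sub_eq_zero] at heq'
      calc (x₀ - y') + (y - z) + (z' - x₀) = y - z - (y' - z') := by abel
        _ = 0 := heq'
    obtain ⟨-, hy, hz⟩ := h hx₀ hx₀ hm'.1 hm.1 hm.2 hm'.2 h0
    rw [hy, hz]
  rw [Finset.card_image_of_injOn hinj, Finset.card_product]

/-- THE FACE INEQUALITY (pattern `(2,1,2)`): if both blocks have the additive TPP, `X₁, X₂` are non-empty and the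
cross pattern with `IJ`- and `KI`-edges from block 2 and `JK`-edge from block 1 is sum-free, then
`|X₂||Y₂||Z₂| + |Y₁||Z₁| ≤ |G|`. -/
theorem AddTPP.face_add_volume_le [Fintype G] {X₁ Y₁ Z₁ X₂ Y₂ Z₂ : Finset G}
    (h1 : AddTPP X₁ Y₁ Z₁) (h2 : AddTPP X₂ Y₂ Z₂) (hX₁ : X₁.Nonempty) (hX₂ : X₂.Nonempty)
    (hc : CrossFree X₂ Y₂ Y₁ Z₁ Z₂ X₂) :
    X₂.card * Y₂.card * Z₂.card + Y₁.card * Z₁.card ≤ Fintype.card G := by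
  obtain ⟨x₀, hx₀⟩ := hX₂
  set S := (X₂ ×ˢ Y₂ ×ˢ Z₂).image (fun t => x₀ + (t.2.1 - t.1 - t.2.2)) with hS
  set B := (Y₁ ×ˢ Z₁).image (fun p => p.1 - p.2) with hB
  have hSc : S.card = X₂.card * Y₂.card * Z₂.card := h2.card_image_translate x₀
  have hBc : B.card = Y₁.card * Z₁.card := h1.card_image_sub hX₁
  have hdisj : Disjoint S B := by
    rw [Finset.disjoint_left]
    intro g hgS hgB
    rw [hS, Finset.mem_image] at hgS
    rw [hB, Finset.mem_image] at hgB
    obtain ⟨⟨x, y, z'⟩, hm, rfl⟩ := hgS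
    obtain ⟨⟨y', z⟩, hm', heq⟩ := hgB
    simp only [Finset.mem_product] at hm hm'
    have heq' : y' - z = x₀ + (y - x - z') := heq
    refine hc hm.1 hm.2.1 hm'.1 hm'.2 hm.2.2 hx₀ ?_
    rw [heq']
    abel
  calc X₂.card * Y₂.card * Z₂.card + Y₁.card * Z₁.card = (S.disjUnion B hdisj).card := by
        rw [Finset.card_disjUnion, hSc, hBc]
    _ ≤ Fintype.card G := Finset.card_le_univ _

/-- THIN BLOCKS NEVER PACK SUPERLINEARLY: under the hypotheses of the face inequality, if the pair is
superlinear (`|G| < v₁ + v₂`) then `|X₁| ≥ 2`.  (By the symmetric patterns the same holds for every side of both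
blocks.) -/
theorem AddTPP.two_le_card_of_superlinear [Fintype G] {X₁ Y₁ Z₁ X₂ Y₂ Z₂ : Finset G}
    (h1 : AddTPP X₁ Y₁ Z₁) (h2 : AddTPP X₂ Y₂ Z₂) (hX₁ : X₁.Nonempty) (hX₂ : X₂.Nonempty)
    (hc : CrossFree X₂ Y₂ Y₁ Z₁ Z₂ X₂)
    (hsup : Fintype.card G < X₁.card * Y₁.card * Z₁.card + X₂.card * Y₂.card * Z₂.card) :
    2 ≤ X₁.card := by
  have hf := h1.face_add_volume_le h2 hX₁ hX₂ hc
  by_contra hlt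
  have hle : X₁.card * Y₁.card * Z₁.card ≤ Y₁.card * Z₁.card :=
    calc X₁.card * Y₁.card * Z₁.card = X₁.card * (Y₁.card * Z₁.card) := Nat.mul_assoc _ _ _
      _ ≤ 1 * (Y₁.card * Z₁.card) := Nat.mul_le_mul_right _ (by omega)
      _ = Y₁.card * Z₁.card := one_mul _
  omega

/-- The face inequality for an accidental-free union of two disjoint complete blocks (via the criterion
`twoBlockAdditive_of_noAccidental`): both `|X₂||Y₂||Z₂| + |Y₁||Z₁| ≤ |G|` and `|X₁||Y₁||Z₁| + |Y₂||Z₂| ≤ |G|`. -/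
theorem NoAccidental.face_add_volume_le [Fintype G] {X₁ Y₁ Z₁ X₂ Y₂ Z₂ : Finset G}
    (hX : Disjoint X₁ X₂) (hY : Disjoint Y₁ Y₂) (hZ : Disjoint Z₁ Z₂) (hX₁ : X₁.Nonempty) (hX₂ : X₂.Nonempty)
    (hN : NoAccidental (id : G → G) id id (blockPairs X₁ Y₁ X₂ Y₂) (blockPairs Y₁ Z₁ Y₂ Z₂)
      (blockPairs Z₁ X₁ Z₂ X₂)) :
    X₂.card * Y₂.card * Z₂.card + Y₁.card * Z₁.card ≤ Fintype.card G ∧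
      X₁.card * Y₁.card * Z₁.card + Y₂.card * Z₂.card ≤ Fintype.card G := by
  obtain ⟨t1, t2, -, c121, -, -, c212, -⟩ := twoBlockAdditive_of_noAccidental hX hY hZ hN
  exact ⟨t1.face_add_volume_le t2 hX₁ hX₂ c212, t2.face_add_volume_le t1 hX₂ hX₁ c121⟩

end TwoBlockFaces

end Summit.MatrixMultiplication.MatrixMultiplication.Theorems.SoloVal
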